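import Summits.KontsevichZagierPeriods.KontsevichZagierPeriods.Theses.IsogenyCertificates
import Summits.KontsevichZagierPeriods.KontsevichZagierPeriods.Theorems.IsogenyCertificatesAlgebraicModuliRealPeriodCellPeriodRep
import Summits.KontsevichZagierPeriods.KontsevichZagierPeriods.Theorems.IsogenyCertificatesAlgebraicModuliRealPeriodCellStubCellCollapse
import Summits.KontsevichZagierPeriods.KontsevichZagierPeriods.Theorems.IsogenyCertificatesAlgebraicModuliRealPeriodCellStubClassReduction
import Summits.KontsevichZagierPeriods.KontsevichZagierPeriods.Theorems.IsogenyCertificatesAlgebraicModuliRealPeriodCellStubDatumOfRealMult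
import Summits.KontsevichZagierPeriods.KontsevichZagierPeriods.Theorems.IsogenyCertificatesAlgebraicModuliRealPeriodCellStubClassKernel
import Summits.KontsevichZagierPeriods.KontsevichZagierPeriods.Theorems.IsogenyCertificatesAlgebraicModuliRealPeriodCellStubXMapTransfer
import Summits.KontsevichZagierPeriods.KontsevichZagierPeriods.Theorems.IsogenyCertificatesAlgebraicModuliRealPeriodCellStubOrbitRatio
import Literature.NumberTheory.Transcendental.KZCalculus

/-!
# Crux `AlgebraicModuliRealPeriodCell` (stmt-KontsevichZagierPeriods-18265), line `Sketch` — the assembled proof (lead prover)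

Conjecture 1 in kernel form on the sector of complete real elliptic integrals of the first kind with
REAL-ALGEBRAIC moduli and scalings: the parent crux's proved ℚ-engine
(`XMapKernelCells.realPeriodCellKernel_relations`) one field up over `ℚ̄ ∩ ℝ`.

The line's stubs, all LANDED as their own files (every statement written out, no definitions):

* S — the representations `[{x³+αx+β>0}, a/√(x³+αx+β)]` exist: LANDED,
  `PeriodRep.stub_algSectorRepsExist` (Theorems/IsogenyCertificatesAlgebraicModuliRealPeriodCellPeriodRep.lean, p142227);
* T — x-map period transfer for real-algebraic data `(f, g, c)` (equal values ⇒
  `[r] − [r'] ∈ KZ.relations`; port of `XMapPeriodTransfer_of` through ten helper files): LANDED,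
  `Transfer.stub_algXMapTransfer` (Theorems/IsogenyCertificatesAlgebraicModuliRealPeriodCellStubXMapTransfer.lean);
* V — along a real-algebraic datum the full real periods have a positive real-algebraic ratio
  (Milne's archimedean factor over `K ⊆ ℝ`): LANDED, `OrbitRatio.stub_algOrbitRatio`
  (Theorems/IsogenyCertificatesAlgebraicModuliRealPeriodCellStubOrbitRatio.lean);
* Ia — Huber–Wüstholz splitting of a real-algebraic relation among full real periods along ℂ-isogeny
  classes: LANDED, `ClassReduction.stub_algClassReduction` (p143139);
* Ib — a REAL lattice multiplier between real-algebraic curves is realised by a real-algebraic datum: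
  LANDED, `DatumOfRealMult.stub_algDatumOfRealMult` (p142996);
* Ic — inside one ℂ-isogeny class, pairwise datum-unrelated real-algebraic curves carry no real-algebraic
  relation among their full real periods: LANDED, `ClassKernel.stub_algClassKernel` (p143532);
* C — S, T, V and independence ⇒ the crux (port of `stub_cellCollapse` with coefficients in `ℚ̄ ∩ ℝ`):
  LANDED, `CellCollapse.stub_algCellCollapse` (Theorems/IsogenyCertificatesAlgebraicModuliRealPeriodCellStubCellCollapse.lean).

`algIndependence_of` glues Ia and Ic into real-period independence over `ℚ̄ ∩ ℝ`, and
`AlgebraicModuliRealPeriodCell_of` concludes the route declaration BY NAME: Conjecture 1 in kernel form holds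
on the sector of complete real elliptic integrals of the first kind with real-algebraic moduli and scalings —
every `ℚ̄ ∩ ℝ`-linear relation among real periods of elliptic curves over real number fields is a chain of
Kontsevich–Zagier moves (transcendence input: Huber–Wüstholz, the tree theorem
`HuberWustholzManyCurvePeriods_holds`; certificates: Jacobi's transformation theory, multipliers included).

References: M. Kontsevich, D. Zagier, *Periods* (2001), §1.2; A. Huber, G. Wüstholz, *Transcendence and
linear relations of 1-periods* (2022), Thm. 15.3; J. H. Silverman, *The Arithmetic of Elliptic Curves* (2009),
III.4, VI.4–VI.5; J. S. Milne, *Arithmetic Duality Theorems* (2006), I.7.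
-/

noncomputable section

namespace Summit.KontsevichZagierPeriods.IsogenyCertificates.AlgRealPeriodCell

open scoped BigOperators
open Literature.NumberTheory.Transcendental
open Summit.KontsevichZagierPeriods.KontsevichZagierPeriods.Theses.IsogenyCertificates

/-- **Real-period independence over `ℚ̄ ∩ ℝ`** from Ia (class reduction) and Ic (class kernel): the
full real periods of pairwise datum-unrelated nonsingular real-algebraic cubics are linearly independent
over the real algebraic numbers. [cite: HuberWustholz2022, Thm. 15.3 (1)] -/
theorem algIndependence_of (hIa : ∀ (k : ℕ) (α β q : Fin k → ℝ), (∀ i, IsAlgebraic ℚ (α i) ∧ IsAlgebraic ℚ (β i) ∧ IsAlgebraic ℚ (q i)) → (∀ i, 4 * α i ^ 3 + 27 * β i ^ 2 ≠ 0) → ∑ i, q i * (∫ x in {x : Fin 1 → ℝ | 0 < x 0 ^ 3 + α i * x 0 + β i}, 1 / Real.sqrt (x 0 ^ 3 + α i * x 0 + β i)) = 0 → ∀ i, ∃ L₀ : PeriodPair, L₀.g₂ = -4 * ((α i : ℝ) : ℂ) ∧ L₀.g₃ = -4 * ((β i : ℝ) : ℂ) ∧ ∀ S : Finset (Fin k),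 (∀ j, j ∈ S ↔ ∃ (L' : PeriodPair) (μ : ℂ), L'.g₂ = -4 * ((α j : ℝ) : ℂ) ∧ L'.g₃ = -4 * ((β j : ℝ) : ℂ) ∧ μ ≠ 0 ∧ ∀ l ∈ L₀.lattice, μ * l ∈ L'.lattice) → ∑ j ∈ S, q j * (∫ x in {x : Fin 1 → ℝ | 0 < x 0 ^ 3 + α j * x 0 + β j}, 1 / Real.sqrt (x 0 ^ 3 + α j * x 0 + β j)) = 0) (hIc : ∀ (k : ℕ) (α β q : Fin k → ℝ) (S : Finset (Fin k)) (L₀ : PeriodPair) (i₀ : Fin k), (∀ i, IsAlgebraic ℚ (α i) ∧ IsAlgebraic ℚ (β i) ∧ IsAlgebraic ℚ (q i)) → (∀ i, 4 * α i ^ 3 + 27 * β i ^ 2 ≠ 0) → L₀.g₂ = -4 * ((α i₀ : ℝ) : ℂ) → L₀.g₃ = -4 * ((β i₀ : ℝ) : ℂ) → (∀ j ∈ S, ∃ (L' : PeriodPair) (μ : ℂ), L'.g₂ = -4 * ((α j : ℝ) : ℂ) ∧ L'.g₃ = -4 * ((β j : ℝ) : ℂ) ∧ μ ≠ 0 ∧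 ∀ l ∈ L₀.lattice, μ * l ∈ L'.lattice) → (∀ i ∈ S, ∀ j ∈ S, i ≠ j → ¬ (∃ (f g : Polynomial ℝ) (c : ℝ), (∀ n, IsAlgebraic ℚ (f.coeff n)) ∧ (∀ n, IsAlgebraic ℚ (g.coeff n)) ∧ IsAlgebraic ℚ c ∧ Polynomial.derivative f * g - f * Polynomial.derivative g ≠ 0 ∧ Polynomial.C (c ^ 2) * g * (f ^ 3 + Polynomial.C (α j) * f * g ^ 2 + Polynomial.C (β j) * g ^ 3) = (Polynomial.X ^ 3 + Polynomial.C (α i) * Polynomial.X + Polynomial.C (β i)) * (Polynomial.derivative f * g - f * Polynomial.derivative g) ^ 2)) → ∑ j ∈ S, q j * (∫ x in {x : Fin 1 → ℝ | 0 < x 0 ^ 3 + α j * x 0 + β j}, 1 / Real.sqrt (x 0 ^ 3 + α j * x 0 + β j)) = 0 → ∀ j ∈ S, q j = 0) : ∀ (k : ℕ) (α β q : Fin k → ℝ), (∀ i, IsAlgebraic ℚ (α i) ∧ IsAlgebraic ℚ (β i) ∧ IsAlgebraic ℚ (q i)) → (∀ i, 4 * α i ^ 3 + 27 * β i ^ 2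 ≠ 0) → (∀ i j, i ≠ j → ¬ (∃ (f g : Polynomial ℝ) (c : ℝ), (∀ n, IsAlgebraic ℚ (f.coeff n)) ∧ (∀ n, IsAlgebraic ℚ (g.coeff n)) ∧ IsAlgebraic ℚ c ∧ Polynomial.derivative f * g - f * Polynomial.derivative g ≠ 0 ∧ Polynomial.C (c ^ 2) * g * (f ^ 3 + Polynomial.C (α j) * f * g ^ 2 + Polynomial.C (β j) * g ^ 3) = (Polynomial.X ^ 3 + Polynomial.C (α i) * Polynomial.X + Polynomial.C (β i)) * (Polynomial.derivative f * g - f * Polynomial.derivative g) ^ 2)) → ∑ i, q i * (∫ x in {x : Fin 1 → ℝ | 0 < x 0 ^ 3 + α i * x 0 + β i}, 1 / Real.sqrt (x 0 ^ 3 + α i * x 0 + β i)) = 0 → ∀ i, q i = 0 := by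
  classical
  intro k α β q halg hns hnd hsum i
  obtain ⟨L₀, h2, h3, hclass⟩ := hIa k α β q halg hns hsum i
  set S : Finset (Fin k) := Finset.univ.filter (fun j => ∃ (L' : PeriodPair) (μ : ℂ), L'.g₂ = -4 * ((α j : ℝ) : ℂ) ∧ L'.g₃ = -4 * ((β j : ℝ) : ℂ) ∧ μ ≠ 0 ∧ ∀ l ∈ L₀.lattice, μ * l ∈ L'.lattice) with hSdef
  have hS : ∀ j, j ∈ S ↔ ∃ (L' : PeriodPair) (μ : ℂ), L'.g₂ = -4 * ((α j : ℝ) : ℂ) ∧ L'.g₃ = -4 * ((β j : ℝ) : ℂ) ∧ μ ≠ 0 ∧ ∀ l ∈ L₀.lattice, μ * l ∈ L'.lattice := by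
    intro j
    simp [hSdef]
  have hsumS := hclass S hS
  have hmem : ∀ j ∈ S, ∃ (L' : PeriodPair) (μ : ℂ), L'.g₂ = -4 * ((α j : ℝ) : ℂ) ∧ L'.g₃ = -4 * ((β j : ℝ) : ℂ) ∧ μ ≠ 0 ∧ ∀ l ∈ L₀.lattice, μ * l ∈ L'.lattice := fun j hj => (hS j).1 hj
  have hnrmS : ∀ i ∈ S, ∀ j ∈ S, i ≠ j → ¬ (∃ (f g : Polynomial ℝ) (c : ℝ), (∀ n, IsAlgebraic ℚ (f.coeff n)) ∧ (∀ n, IsAlgebraic ℚ (g.coeff n)) ∧ IsAlgebraic ℚ c ∧ Polynomial.derivative f * g - f * Polynomial.derivative g ≠ 0 ∧ Polynomial.C (c ^ 2) * g * (f ^ 3 + Polynomial.C (α j) * f * g ^ 2 + Polynomial.C (β j) * g ^ 3) = (Polynomial.X ^ 3 + Polynomial.C (α i) * Polynomial.X + Polynomial.C (β i)) * (Polynomial.derivative f * g - f * Polynomial.derivative g) ^ 2) := fun i _ j _ hij => hnd i j hij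
  have hi : i ∈ S := (hS i).2 ⟨L₀, 1, h2, h3, one_ne_zero, fun l hl => by simpa using hl⟩
  exact hIc k α β q S L₀ i halg hns h2 h3 hmem hnrmS hsumS i hi

/-- **The crux `AlgebraicModuliRealPeriodCell`, by name, from the registered stubs.** -/
theorem AlgebraicModuliRealPeriodCell_of : AlgebraicModuliRealPeriodCell := by
  unfold AlgebraicModuliRealPeriodCell
  exact CellCollapse.stub_algCellCollapse PeriodRep.stub_algSectorRepsExist Transfer.stub_algXMapTransfer
    OrbitRatio.stub_algOrbitRatio
    (algIndependence_of ClassReduction.stub_algClassReduction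
      (ClassKernel.stub_algClassKernel DatumOfRealMult.stub_algDatumOfRealMult))

end Summit.KontsevichZagierPeriods.IsogenyCertificates.AlgRealPeriodCell

end
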